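import Summits.QuantumFields.BalabanUV.Beta.GAN24.PiBmConstants
import Summits.QuantumFields.BalabanUV.Beta.GAN24.LinT2ZeroModeStep

/-!
# `BalabanUV.Beta.GAN24.CoDressedColumnSourceSums` — binder row G-an2-4 / (CONV-C), W-slot CT-route «CT-W» ((W-γ); gan24-p2 g35's `CT-W-SCOPE-v0.md` §2
# (F3)(i) and the OWNER's RULING R-gan24p1-g22-1 «CT-W DESIGN v0» (W6) «FINDING ADOPTED — (R-W3-dressed) CLOSED»): **THE COARSE-SOURCE SUMS OF THE
# CO-DRESSED `ℋ`-COLUMNS ARE NOT POSITION-INDEPENDENT** — for a block-covariant kernel with Kronecker source sums (an4's `KInvStep Lc j`: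
# `LinT2ZeroModeStep.hasSum_KInvStep_col`) the `Π_bm`-dressed columns of `coDressKBmAt ρ N K` (`colH_coDressKBmAt_eq`) have source sums
# `N · cR` ON THE BLOCK-EXIT BONDS AND ZERO INSIDE BLOCKS.  HENCE the hypothesis `hR` of leaf-02's `LinT2ZeroMode.zmode_one_linT2` (position-independent
# source sums of the four legs) FAILS for the co-dressed step resolvent `G_j = coDressKBmAt ρ Lc (KInvStep Lc j)` of `SpineRecursiveW`, and the undressed (Z0)
# `LinT2ZeroModeStep.zmode_one_linT2_unitKInvStep_step′` does NOT transfer to the dressed linear transport by renaming `K ↦ G`.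

NOT IN PRINT; OUR BOOKKEEPING (G-an2-4 crux team (2), leaf prover `b2b-balaban-gan24-formalise-leaf-02`, gen 51; journal [LEAF02-G51-INTENT1]; memo
`HOME/b2b-balaban-gan24-formalise-leaf-02/g51/ctw/CT-W-F3i-LOCATED-v1.md`).  PRIOR ART BY NAME: the projector-side fact «`Π_bm` does NOT fix constants» is
the row owner's RULINGS-16 (R16-1), in the tree as gan24-p4 g28's `GAN24/PiBmConstants` (`axProjBmAt_const`, `coProjBmW_const`, `tsum_pmBm_row`, and the S-slot
double-leg twin `tsum_prod_dressKBmAt_inl_inl`) over gan24-p4 g27's `GAN24/AxProjBmWindow` — re-located for the W-slot by leaf-06 g42's PRE-READ P-leaf06g42-1;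
this file is the KERNEL-COLUMN ∕ `KInvStep` read-out those modules do not contain.  HONEST FRAMING (cell contract, verbatim): «discharging `BetaPertH` makes
Bałaban's UV stability UNCONDITIONAL — a real constructive-QFT result; it is NOT the continuum limit and NOT the Clay problem.»  HONEST DEPENDENCY (verbatim):
«continuum YM on T⁴ ⇐ BetaPertH ∧ nine spine estimates (0/9 proved); BetaPertH ⇐ (D1) ∧ (D4) ∧ CAP+tail; G-an2-4 gates asym, D1 and NE2/3/4.»  [folklore] lattice
bookkeeping over an2's `AxialDressingRooted.coDressKBmAt` ∕ `colH_coDressKBmAt_eq` ∕ `coProjBmW`, an4's `OneStepKernelFamily.colH` ∕ `KInvStep`, my lineage's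
`LinT2ZeroModeStep.colMass` ∕ `hasSum_KInvStep_col` and gan24-p4's `PiBmConstants.coProjBmW_const`, all BY NAME; generic `d`, in-block root; 0 `def`, 0 cited facts,
0 `def … : Prop`, 0 sorry.  NO estimate of Bałaban's; a LOCATED NEGATIVE for the verbatim transfer, discharging NOTHING of (hW, hWall); 0 wall binders; NEVER «G-an2-4
closed» as (CONV-C); NOT D1, NOT BetaPertH, NOT continuum, NOT Clay.

## What (`d + 1` dimensions, in-block root `ρ = toSite r`, `r ∈ box (d+1) N`)
* §1 **`tsum_source_colH_coDressKBmAt`**: for `K` with source sums `Σ'_y K u (N•y) (inl κ′) (inr μ) = cR κ′ μ` at every fine `u` (`1 ≤ N`),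
  `Σ'_y colH (coDressKBmAt ρ N K) N μ y κ u = if u κ % N = N − 1 then N · cR κ μ else 0`; `summable_source_colH_coDressKBmAt`.
* §2 the instance **`tsum_source_colH_coDressKBm_KInvStep`** (`N = Lc`, `K = KInvStep Lc j`, every `j`); at the origin bond (`2 ≤ Lc`) the sum is `0` (`…_zero`),
  at the last bond of the origin block it is `Lc · colMass d Lc j κ μ` (`…_last`); `colMass_self_ne_zero`.
* §3 **`not_exists_hasSum_source_coDressKBm_KInvStep`** (`2 ≤ Lc`): there is NO constant `c` with `HasSum (fun y ↦ G_j u (Lc•y) (inl κ) (inr κ)) c` for every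
  fine `u` — the `(inl κ, inr κ)` instance of `LinT2ZeroMode.zmode_one_linT2`'s hypothesis `hR` is UNSATISFIABLE for `G_j = coDressKBmAt ρ Lc (KInvStep Lc j)`.
  CONTRAST (tree): the undressed `hasSum_KInvStep_col` (position-independent); `SrecChargeBm.tsum_colH_coDressKBmAt` (the FIELD-POINT totals of the dressed
  columns ARE the undressed ones — the (Z-b) law sums the other index); the S-slot double-leg twin `PiBmConstants.tsum_prod_dressKBmAt_inl_inl`.
* §4 (v2.1, gan24-p2 g35's `CT-W-F2-FIRST-TEST-v0.md` §2 (Q-lin) «the row family is its twin through `trK`»): `comp_trK_piKBm_inr`, **`rowH_coDressKBmAt`** (the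
  `(inr α, inl a)` entry of the co-dressed kernel as a windowed `Π_bm`-image in its field index), **`tsum_source_rowH_coDressKBmAt`** (`hL`-shape source sums =
  `if y a % N = N − 1 then N·cL α a else 0`), the `KInvStep` instance, and **`not_exists_hasSum_row_coDressKBm_KInvStep`** — `zmode_one_linT2`'s ROW hypothesis `hL` fails too.
-/

noncomputable section

open Finset
open scoped BigOperators
open Literature.MathematicalPhysics.QuantumFieldTheory
open Literature.MathematicalPhysics.QuantumFieldTheory.Balaban1983to89
open Literature.MathematicalPhysics.QuantumFieldTheory.Balaban1983to89.Beta
open ExpKernelCalculus (MKer)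
open AffineAveraging (box toSite)
open OneStepResolventKernel (Fib)
open OneStepKernelFamily (colH KInvStep)
open Summit.QuantumFields.BalabanUV.Beta.AxialDressingRooted (pmBm cube coProjBmW coProjBmW_apply coDressKBmAt coDressKBmAt_eq colH_coDressKBmAt_eq piKBm
  piKBm_inl_inr piKBm_inr_inr sum_piKBm_col_inl tsum_window' tsum_point')
open Summit.QuantumFields.BalabanUV.Beta.GAN24.PiBmConstants (coProjBmW_const)
open Summit.QuantumFields.BalabanUV.Beta.GAN24.LinT2ZeroModeStep (colMass hasSum_KInvStep_col hasSum_KInvStep_row)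

namespace Summit.QuantumFields.BalabanUV.Beta.GAN24.CoDressedColumnSourceSums

variable {d : ℕ}

/-! ## §1 Source sums of the co-dressed `ℋ`-columns -/

/-- [folklore] Each window term of the co-dressed column is summable over the coarse source. -/
theorem summable_window_term {N : ℕ} (r : Fin (d + 1) → ℕ) {K : MKer (d + 1) (Fib d)} {cR : Fin (d + 1) → Fin (d + 1) → ℝ}
    (hR : ∀ (u : Fin (d + 1) → ℤ) (κ' μ : Fin (d + 1)), HasSum (fun y : Fin (d + 1) → ℤ => K u ((N : ℤ) • y) (Sum.inl κ') (Sum.inr μ)) (cR κ' μ))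
    (μ κ κ' : Fin (d + 1)) (u v : Fin (d + 1) → ℤ) :
    Summable fun y : Fin (d + 1) → ℤ => pmBm (toSite r) N κ u κ' (u - v) * colH K N μ y κ' (u - v) :=
  ((hR (u - v) κ' μ).mul_left (pmBm (toSite r) N κ u κ' (u - v))).summable

/-- NOT IN PRINT; OUR BOOKKEEPING.  **THE COARSE-SOURCE SUMS OF THE CO-DRESSED `ℋ`-COLUMNS** (in-block root, `1 ≤ N`): if the undressed columns have
position-independent source sums, `Σ'_y K u (N•y) (inl κ′) (inr μ) = cR κ′ μ` for every fine `u`, then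
`Σ'_y colH (coDressKBmAt ρ N K) N μ y κ u = if u κ % N = N − 1 then N · cR κ μ else 0` — `Π_bm` of the constant form `κ′ ↦ cR κ′ μ`
(gan24-p4 g28's `PiBmConstants.coProjBmW_const`): `N · cR κ μ` on the block-EXIT bonds, ZERO inside blocks — NOT the constant `cR κ μ`. -/
theorem tsum_source_colH_coDressKBmAt {N : ℕ} (hN : 1 ≤ N) {r : Fin (d + 1) → ℕ} (hr : r ∈ box (d + 1) N) {K : MKer (d + 1) (Fib d)}
    {cR : Fin (d + 1) → Fin (d + 1) → ℝ}
    (hR : ∀ (u : Fin (d + 1) → ℤ) (κ' μ : Fin (d + 1)), HasSum (fun y : Fin (d + 1) → ℤ => K u ((N : ℤ) • y) (Sum.inl κ') (Sum.inr μ)) (cR κ' μ))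
    (μ κ : Fin (d + 1)) (u : Fin (d + 1) → ℤ) :
    ∑' y : Fin (d + 1) → ℤ, colH (coDressKBmAt (toSite r) N K) N μ y κ u
      = if u κ % (N : ℤ) = (N : ℤ) - 1 then (N : ℝ) * cR κ μ else 0 := by
  have e1 : (fun y : Fin (d + 1) → ℤ => colH (coDressKBmAt (toSite r) N K) N μ y κ u)
      = fun y => ∑ v ∈ cube (d + 1) N, ∑ κ' : Fin (d + 1), pmBm (toSite r) N κ u κ' (u - v) * colH K N μ y κ' (u - v) := by
    funext y
    rw [colH_coDressKBmAt_eq, coProjBmW_apply]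
  rw [e1, Summable.tsum_finsetSum (fun v _ => summable_sum fun κ' _ => summable_window_term r hR μ κ κ' u v)]
  rw [Finset.sum_congr rfl fun v _ => Summable.tsum_finsetSum (fun κ' _ => summable_window_term r hR μ κ κ' u v)]
  have e2 : ∀ (v : Fin (d + 1) → ℤ) (κ' : Fin (d + 1)),
      ∑' y : Fin (d + 1) → ℤ, pmBm (toSite r) N κ u κ' (u - v) * colH K N μ y κ' (u - v) = pmBm (toSite r) N κ u κ' (u - v) * cR κ' μ :=
    fun v κ' => ((hR (u - v) κ' μ).mul_left _).tsum_eq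
  simp_rw [e2]
  have e3 := congrFun (congrFun (coProjBmW_const hN hr (fun κ' => cR κ' μ)) κ) u
  rw [coProjBmW_apply] at e3
  exact e3

/-- [folklore] The co-dressed column's source series is summable (finite window of summable series). -/
theorem summable_source_colH_coDressKBmAt {N : ℕ} (r : Fin (d + 1) → ℕ) {K : MKer (d + 1) (Fib d)} {cR : Fin (d + 1) → Fin (d + 1) → ℝ}
    (hR : ∀ (u : Fin (d + 1) → ℤ) (κ' μ : Fin (d + 1)), HasSum (fun y : Fin (d + 1) → ℤ => K u ((N : ℤ) • y) (Sum.inl κ') (Sum.inr μ)) (cR κ' μ))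
    (μ κ : Fin (d + 1)) (u : Fin (d + 1) → ℤ) :
    Summable fun y : Fin (d + 1) → ℤ => colH (coDressKBmAt (toSite r) N K) N μ y κ u := by
  have e1 : (fun y : Fin (d + 1) → ℤ => colH (coDressKBmAt (toSite r) N K) N μ y κ u)
      = fun y => ∑ v ∈ cube (d + 1) N, ∑ κ' : Fin (d + 1), pmBm (toSite r) N κ u κ' (u - v) * colH K N μ y κ' (u - v) := by
    funext y
    rw [colH_coDressKBmAt_eq, coProjBmW_apply]
  rw [e1]
  exact summable_sum fun v _ => summable_sum fun κ' _ => summable_window_term r hR μ κ κ' u v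

/-! ## §2 The instance: the co-dressed step resolvent `G_j = coDressKBmAt ρ Lc (KInvStep Lc j)` -/

section Step

variable {Lc : ℕ} [NeZero Lc]

/-- NOT IN PRINT; OUR BOOKKEEPING.  **SOURCE SUMS OF THE CO-DRESSED STEP RESOLVENT'S `ℋ`-COLUMNS** (every `j`, in-block root):
`Σ'_y colH (coDressKBmAt ρ Lc (KInvStep Lc j)) Lc μ y κ u = if u κ % Lc = Lc − 1 then Lc · colMass d Lc j κ μ else 0` — the undressed value
`colMass d Lc j κ μ` (`LinT2ZeroModeStep.hasSum_KInvStep_col`, position-independent) is REPLACED by `Lc·colMass` on the exit bonds and `0` inside blocks. -/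
theorem tsum_source_colH_coDressKBm_KInvStep {r : Fin (d + 1) → ℕ} (hr : r ∈ box (d + 1) Lc) (j : ℕ) (μ κ : Fin (d + 1))
    (u : Fin (d + 1) → ℤ) :
    ∑' y : Fin (d + 1) → ℤ, colH (coDressKBmAt (toSite r) Lc (KInvStep (d := d) Lc j)) Lc μ y κ u
      = if u κ % (Lc : ℤ) = (Lc : ℤ) - 1 then (Lc : ℝ) * colMass d Lc j κ μ else 0 :=
  tsum_source_colH_coDressKBmAt NeZero.one_le hr (cR := fun κ' μ => colMass d Lc j κ' μ)
    (fun u κ' μ => hasSum_KInvStep_col (d := d) (Lc := Lc) j u κ' μ) μ κ u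

/-- [folklore] At the origin bond (`2 ≤ Lc`) the co-dressed column's source sum VANISHES. -/
theorem tsum_source_colH_coDressKBm_KInvStep_zero (hLc : 2 ≤ Lc) {r : Fin (d + 1) → ℕ} (hr : r ∈ box (d + 1) Lc) (j : ℕ) (μ κ : Fin (d + 1)) :
    ∑' y : Fin (d + 1) → ℤ, colH (coDressKBmAt (toSite r) Lc (KInvStep (d := d) Lc j)) Lc μ y κ 0 = 0 := by
  rw [tsum_source_colH_coDressKBm_KInvStep hr, if_neg]
  simp only [Pi.zero_apply, Int.zero_emod]
  have : (2 : ℤ) ≤ Lc := by exact_mod_cast hLc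
  omega

/-- [folklore] At the last bond of the origin block, `u = (Lc−1)·𝟙`, it is `Lc · colMass d Lc j κ μ`. -/
theorem tsum_source_colH_coDressKBm_KInvStep_last {r : Fin (d + 1) → ℕ} (hr : r ∈ box (d + 1) Lc) (j : ℕ) (μ κ : Fin (d + 1)) :
    ∑' y : Fin (d + 1) → ℤ, colH (coDressKBmAt (toSite r) Lc (KInvStep (d := d) Lc j)) Lc μ y κ (fun _ => (Lc : ℤ) - 1)
      = (Lc : ℝ) * colMass d Lc j κ μ := by
  rw [tsum_source_colH_coDressKBm_KInvStep hr, if_pos]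
  have h1 : (1 : ℕ) ≤ Lc := NeZero.one_le
  have h0 : (0 : ℤ) ≤ (Lc : ℤ) - 1 := by omega
  exact Int.emod_eq_of_lt h0 (by omega)

/-- [folklore] The diagonal coset mass is nonzero: `colMass d Lc j κ κ = (Lc^{j+1})^{−(d+2)} ≠ 0`. -/
theorem colMass_self_ne_zero (j : ℕ) (κ : Fin (d + 1)) : colMass d Lc j κ κ ≠ 0 := by
  simp only [colMass, if_true]
  have hL : ((Lc ^ (j + 1) : ℕ) : ℝ) ≠ 0 := by exact_mod_cast pow_ne_zero _ (NeZero.ne Lc)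
  exact inv_ne_zero (pow_ne_zero _ hL)

/-! ## §3 The located negative: `hR` of `LinT2ZeroMode.zmode_one_linT2` is unsatisfiable for the co-dressed step resolvent -/

/-- NOT IN PRINT; OUR BOOKKEEPING.  **THE POSITION-INDEPENDENT SOURCE-SUM HYPOTHESIS FAILS FOR THE CO-DRESSED STEP RESOLVENT** (`2 ≤ Lc`, every `j`,
in-block root): there is NO constant `c` with `HasSum (fun y ↦ G_j u (Lc•y) (inl κ) (inr κ)) c` for every fine `u`, `G_j = coDressKBmAt ρ Lc (KInvStep Lc j)` —
the `(b, β) = (inl κ, κ)` instance of `LinT2ZeroMode.zmode_one_linT2`'s `hR` (and hence the verbatim `K ↦ G` transfer of `LinT2ZeroModeStep.zmode_one_linT2_KInvStep′`)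
is REFUTED: the sum is `0` at the origin bond and `Lc·(Lc^{j+1})^{−(d+2)} ≠ 0` at the last bond of the origin block. -/
theorem not_exists_hasSum_source_coDressKBm_KInvStep (hLc : 2 ≤ Lc) {r : Fin (d + 1) → ℕ} (hr : r ∈ box (d + 1) Lc) (j : ℕ) (κ : Fin (d + 1)) :
    ¬ ∃ c : ℝ, ∀ u : Fin (d + 1) → ℤ,
      HasSum (fun y : Fin (d + 1) → ℤ => coDressKBmAt (toSite r) Lc (KInvStep (d := d) Lc j) u ((Lc : ℤ) • y) (Sum.inl κ) (Sum.inr κ)) c := by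
  rintro ⟨c, hc⟩
  have h0 := (hc 0).tsum_eq
  have h1 := (hc (fun _ => (Lc : ℤ) - 1)).tsum_eq
  have e0 := tsum_source_colH_coDressKBm_KInvStep_zero (d := d) hLc hr j κ κ
  have e1 := tsum_source_colH_coDressKBm_KInvStep_last (d := d) hr j κ κ
  simp only [colH] at e0 e1
  rw [h0] at e0
  rw [h1] at e1
  have hL : (Lc : ℝ) ≠ 0 := Nat.cast_ne_zero.mpr (NeZero.ne Lc)
  have hm := colMass_self_ne_zero (d := d) (Lc := Lc) j κ
  rw [e0] at e1
  exact (mul_ne_zero hL hm) e1.symm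

end Step


/-! ## §4 The ROW family (left sandwich leg): `x′ ↦ G (N•x′) y (inr α) (inl a)` — the twin through `trK` (gan24-p2 g35's `CT-W-F2-FIRST-TEST-v0.md` §2 (Q-lin)) -/

section Row

variable {N : ℕ} (ρ : Fin (d + 1) → ℤ)

/-- [folklore] Left composition with `piKBmᵀ` does not touch a multiplier ROW (twin of an2's `comp_piKBm_inr`). -/
theorem comp_trK_piKBm_inr (A : MKer (d + 1) (Fib d)) (x t : Fin (d + 1) → ℤ) (α : Fin (d + 1)) (e : Fib d) :
    ExpKernelCalculus.comp (TameKernelCalculus.trK (piKBm ρ N)) A x t (Sum.inr α) e = A x t (Sum.inr α) e := by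
  unfold ExpKernelCalculus.comp
  have h : ∀ s, ∑ c : Fib d, TameKernelCalculus.trK (piKBm ρ N) x s (Sum.inr α) c * A s t c e = if s = x then A s t (Sum.inr α) e else 0 := by
    intro s
    rw [Fintype.sum_sum_type]
    simp only [TameKernelCalculus.trK_apply, piKBm_inl_inr, piKBm_inr_inr, zero_mul, Finset.sum_const_zero, zero_add]
    by_cases hs : s = x
    · simp only [hs, true_and, ite_mul, one_mul, zero_mul, Finset.sum_ite_eq', Finset.mem_univ, if_true]
    · simp [hs]
  simp_rw [h]
  rw [tsum_point']

/-- NOT IN PRINT; OUR BOOKKEEPING.  **THE (multiplier-ROW, field-COLUMN) ENTRY OF THE CO-DRESSED KERNEL** is the windowed `Π_bm`-image of the same entry of `K`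
in its FIELD index: `coDressKBmAt ρ N K x y (inr α) (inl a) = Σ_{v ∈ cube} Σ_κ pmBm ρ N a y κ (y − v) · K x (y − v) (inr α) (inl κ)` (twin of an2's `colH_coDressKBmAt`). -/
theorem rowH_coDressKBmAt (K : MKer (d + 1) (Fib d)) (x y : Fin (d + 1) → ℤ) (α a : Fin (d + 1)) :
    coDressKBmAt ρ N K x y (Sum.inr α) (Sum.inl a)
      = ∑ v ∈ cube (d + 1) N, ∑ κ : Fin (d + 1), pmBm ρ N a y κ (y - v) * K x (y - v) (Sum.inr α) (Sum.inl κ) := by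
  rw [coDressKBmAt_eq]
  unfold ExpKernelCalculus.comp
  have h1 : ∀ t (e : Fib d), (∑' s, ∑ c : Fib d, TameKernelCalculus.trK (piKBm ρ N) x s (Sum.inr α) c * K s t c e) = K x t (Sum.inr α) e :=
    fun t e => comp_trK_piKBm_inr ρ K x t α e
  simp_rw [h1]
  have h2 : ∀ t, ∑ e : Fib d, K x t (Sum.inr α) e * piKBm ρ N t y e (Sum.inl a)
      = if y - t ∈ cube (d + 1) N then ∑ κ : Fin (d + 1), pmBm ρ N a y κ t * K x t (Sum.inr α) (Sum.inl κ) else 0 := by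
    intro t
    have h := sum_piKBm_col_inl ρ N t y a (fun e => K x t (Sum.inr α) e)
    rw [← h]
    exact Finset.sum_congr rfl fun e _ => mul_comm _ _
  simp_rw [h2]
  rw [tsum_window']

variable {ρ}

/-- [folklore] Each window term of the row family is summable over the coarse multiplier position. -/
theorem summable_window_term_row (r : Fin (d + 1) → ℕ) {K : MKer (d + 1) (Fib d)} {cL : Fin (d + 1) → Fin (d + 1) → ℝ}
    (hL : ∀ (t : Fin (d + 1) → ℤ) (α κ : Fin (d + 1)), HasSum (fun x' : Fin (d + 1) → ℤ => K ((N : ℤ) • x') t (Sum.inr α) (Sum.inl κ)) (cL α κ))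
    (α a κ : Fin (d + 1)) (y v : Fin (d + 1) → ℤ) :
    Summable fun x' : Fin (d + 1) → ℤ => pmBm (toSite r) N a y κ (y - v) * K ((N : ℤ) • x') (y - v) (Sum.inr α) (Sum.inl κ) :=
  ((hL (y - v) α κ).mul_left _).summable

/-- NOT IN PRINT; OUR BOOKKEEPING.  **THE COARSE-SOURCE SUMS OF THE ROW FAMILY** (in-block root, `1 ≤ N`): if `Σ'_{x′} K (N•x′) t (inr α) (inl κ) = cL α κ` at every fine `t`
(`zmode_one_linT2`'s `hL` shape), then `Σ'_{x′} coDressKBmAt ρ N K (N•x′) y (inr α) (inl a) = if y a % N = N − 1 then N · cL α a else 0` — again `Π_bm` of a constant form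
(`PiBmConstants.coProjBmW_const`), NOT the constant `cL α a`. -/
theorem tsum_source_rowH_coDressKBmAt (hN : 1 ≤ N) {r : Fin (d + 1) → ℕ} (hr : r ∈ box (d + 1) N) {K : MKer (d + 1) (Fib d)}
    {cL : Fin (d + 1) → Fin (d + 1) → ℝ}
    (hL : ∀ (t : Fin (d + 1) → ℤ) (α κ : Fin (d + 1)), HasSum (fun x' : Fin (d + 1) → ℤ => K ((N : ℤ) • x') t (Sum.inr α) (Sum.inl κ)) (cL α κ))
    (α a : Fin (d + 1)) (y : Fin (d + 1) → ℤ) :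
    ∑' x' : Fin (d + 1) → ℤ, coDressKBmAt (toSite r) N K ((N : ℤ) • x') y (Sum.inr α) (Sum.inl a)
      = if y a % (N : ℤ) = (N : ℤ) - 1 then (N : ℝ) * cL α a else 0 := by
  simp_rw [rowH_coDressKBmAt]
  rw [Summable.tsum_finsetSum (fun v _ => summable_sum fun κ _ => summable_window_term_row r hL α a κ y v)]
  rw [Finset.sum_congr rfl fun v _ => Summable.tsum_finsetSum (fun κ _ => summable_window_term_row r hL α a κ y v)]
  have e2 : ∀ (v : Fin (d + 1) → ℤ) (κ : Fin (d + 1)),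
      ∑' x' : Fin (d + 1) → ℤ, pmBm (toSite r) N a y κ (y - v) * K ((N : ℤ) • x') (y - v) (Sum.inr α) (Sum.inl κ) = pmBm (toSite r) N a y κ (y - v) * cL α κ :=
    fun v κ => ((hL (y - v) α κ).mul_left _).tsum_eq
  simp_rw [e2]
  have e3 := congrFun (congrFun (coProjBmW_const hN hr (fun κ => cL α κ)) a) y
  rw [coProjBmW_apply] at e3
  exact e3

variable {Lc : ℕ} [NeZero Lc]

/-- NOT IN PRINT; OUR BOOKKEEPING.  **ROW-FAMILY SOURCE SUMS OF THE CO-DRESSED STEP RESOLVENT** (every `j`, in-block root):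
`Σ'_{x′} G_j (Lc•x′) y (inr α) (inl a) = if y a % Lc = Lc − 1 then −Lc · colMass d Lc j a α else 0` (`LinT2ZeroModeStep.hasSum_KInvStep_row` + `coProjBmW_const`). -/
theorem tsum_source_rowH_coDressKBm_KInvStep {r : Fin (d + 1) → ℕ} (hr : r ∈ box (d + 1) Lc) (j : ℕ) (α a : Fin (d + 1)) (y : Fin (d + 1) → ℤ) :
    ∑' x' : Fin (d + 1) → ℤ, coDressKBmAt (toSite r) Lc (KInvStep (d := d) Lc j) ((Lc : ℤ) • x') y (Sum.inr α) (Sum.inl a)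
      = if y a % (Lc : ℤ) = (Lc : ℤ) - 1 then (Lc : ℝ) * (-colMass d Lc j a α) else 0 :=
  tsum_source_rowH_coDressKBmAt NeZero.one_le hr (cL := fun α κ => -colMass d Lc j κ α)
    (fun t α κ => hasSum_KInvStep_row (d := d) (Lc := Lc) j t α κ) α a y

/-- NOT IN PRINT; OUR BOOKKEEPING.  **THE ROW HYPOTHESIS `hL` OF `LinT2ZeroMode.zmode_one_linT2` IS UNSATISFIABLE FOR THE CO-DRESSED STEP RESOLVENT TOO** (`2 ≤ Lc`):
no constant `c` has `HasSum (fun x′ ↦ G_j (Lc•x′) y (inr α) (inl α)) c` for every fine `y` (`0` at the origin bond, `−Lc·colMass ≠ 0` at the last bond of the origin block). -/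
theorem not_exists_hasSum_row_coDressKBm_KInvStep (hLc : 2 ≤ Lc) {r : Fin (d + 1) → ℕ} (hr : r ∈ box (d + 1) Lc) (j : ℕ) (α : Fin (d + 1)) :
    ¬ ∃ c : ℝ, ∀ y : Fin (d + 1) → ℤ,
      HasSum (fun x' : Fin (d + 1) → ℤ => coDressKBmAt (toSite r) Lc (KInvStep (d := d) Lc j) ((Lc : ℤ) • x') y (Sum.inr α) (Sum.inl α)) c := by
  rintro ⟨c, hc⟩
  have h0 := (hc 0).tsum_eq
  have h1 := (hc (fun _ => (Lc : ℤ) - 1)).tsum_eq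
  rw [tsum_source_rowH_coDressKBm_KInvStep hr j α α 0, if_neg (by
    simp only [Pi.zero_apply, Int.zero_emod]
    have : (2 : ℤ) ≤ Lc := by exact_mod_cast hLc
    omega)] at h0
  rw [tsum_source_rowH_coDressKBm_KInvStep hr j α α, if_pos (by
    have h1' : (1 : ℕ) ≤ Lc := NeZero.one_le
    exact Int.emod_eq_of_lt (by omega) (by omega))] at h1
  have hL : (Lc : ℝ) ≠ 0 := Nat.cast_ne_zero.mpr (NeZero.ne Lc)
  have hm := colMass_self_ne_zero (d := d) (Lc := Lc) j α
  rw [← h0] at h1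
  exact (mul_ne_zero hL (neg_ne_zero.mpr hm)) h1

end Row

end Summit.QuantumFields.BalabanUV.Beta.GAN24.CoDressedColumnSourceSums

end
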